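/-
Origin: expansion seat `planner-pub-hodgecm-pv09-0`, handover 2026-08-18T03:42:11Z (`HOME/pub-hodgecm-pv09/lean/Pv09/SpectralN22.lean`, md5 69571598, 100 lines);
landed by the gen-5 packager in gate run 19 as `HodgeCM/PerL34/SpectralN22.lean` (import ^import Pv[0-9]+\.→import HodgeCM.PerL34. ×1).
-/
/-
pub-hodgecm speedrun cell, prover pv09 — WIP module `Pv09.SpectralN22` (landing target
`HodgeCM/PerL34/SpectralN22.lean`).  Imports: the LANDED carver file `HodgeCM.PerL34.Isolation` (typed node
`N22_spectral`) + `Pv09.Spectral` (→ `HodgeCM.PerL34.Spectral`).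

# Node N22 (PerL v5 §3.3 spectral paragraph, tex ll. 384–396) — HONEST SPLIT (L2)

The carver typed N22 as the conjunction `N22_spectral T` = (i) ∧ (ii):
 (i)  (l. 386–387) e_σ̂ preserves every closed `R(U(W)(𝔸))`-invariant subspace            — frozen `AX9_espectral`
 (ii) (l. 435–437) a closed invariant `M` meeting a `σ̂` in which `w` occurs contains a non-zero `w`-isotypic
      vector of `σ̂`                                                                        — frozen `AX9_w_vector`
Here (i) is KERNEL-PROVED (`N22_espectral_of_isotypic`, via `Pv09.Spectral`) from the single definition-level
input
  X₁ `IsotypicStable T` : each σ̂ of the model is stable under the commutant `R(U(W)(𝔸))′`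
— the characteristic property of an ISOTYPIC component (l. 385 "L²([U(W)]) is the Hilbert direct sum of its
isotypic components σ̂"): the frozen interface posits the σ̂ as abstract closed invariant pairwise-orthogonal
complete DATA (`hatσ*` fields) but not their isotypic nature, so X₁ is exactly the missing content of the word
"isotypic"; it is NOT provable from the `hatσ*` fields (a diagonal copy inside σ ⊕ σ split as two summands is a
closed invariant subspace not preserved by either projection).  Conjunct (ii) is representation theory of the
compact torus `T(L₀⊗ℝ)` inside `σ̂ ≅ σ^{⊕m}` and stays the labelled input X₂ `WVector T` (verbatim the frozen
shape).  So:  `N22_of_inputs : IsotypicStable T → WVector T → N22_spectral T`, with (i) kernel-discharged.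
Also proved: the interface's `eσ i` IS the orthogonal projection onto `hatσ i` (`eσ_eq_starProjection`, from
`eσ_mem/eσ_fix/eσ_selfAdjoint`).
-/
import Summits.HodgeConjecture.HodgeCM.PerL34.Isolation
import Summits.HodgeConjecture.HodgeCM.PerL34.Spectral

/-! PORT of `HodgeCM/PerL34/SpectralN22.lean` (HodgeCMPerL run 82) — verbatim mechanical port; provenance in the PORT header line. -/

set_option autoImplicit false

noncomputable section

namespace HodgeCM
namespace PerL34

open HodgeCM.Prior.Perl34File
open scoped InnerProductSpace

variable {U : Universe} (T : U.ThetaModel)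

/-- **X₁ (definition-level input, tex l. 385)**: the `σ̂` of the model are isotypic components, i.e. stable under
every bounded operator commuting with `R(U(W)(𝔸))`. -/
def IsotypicStable : Prop :=
  ∀ {L : CMField} {ι₁ : L →+* ℂ} (V : HermSpace3 L ι₁) (c : SeesawCtx L) (i : T.SigIdx V c)
    (A : T.H V c →L[ℂ] T.H V c), A ∈ Set.centralizer (Set.range (T.core V c).R) →
    ∀ x ∈ (T.core V c).hatσ i, A x ∈ (T.core V c).hatσ i

/-- **X₂ (representation-theoretic input, tex ll. 435–437)** = conjunct (ii) of `N22_spectral`, verbatim. -/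
def WVector : Prop :=
  ∀ {L : CMField} {ι₁ : L →+* ℂ} (V : HermSpace3 L ι₁) (c : SeesawCtx L),
    ∀ (M : Submodule ℂ (T.H V c)), IsClosed (M : Set (T.H V c)) →
      (∀ g, ∀ v ∈ M, (T.core V c).R g v ∈ M) → ∀ i, (T.t12 V c).wOccurs i →
        M ⊓ (T.core V c).hatσ i ≠ ⊥ → ∃ v ∈ M ⊓ (T.core V c).hatσ i, v ≠ 0 ∧ (T.t12 V c).Pw v = v

section
variable {T}
variable {L : CMField} {ι₁ : L →+* ℂ} (V : HermSpace3 L ι₁) (c : SeesawCtx L)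

/-- A closed submodule of the (complete) `L²([U(W)])` has an orthogonal projection. -/
theorem hasOrthogonalProjection_of_isClosed (M : Submodule ℂ (T.H V c)) (hM : IsClosed (M : Set (T.H V c))) :
    M.HasOrthogonalProjection := by
  haveI : CompleteSpace M := hM.completeSpace_coe
  exact Submodule.HasOrthogonalProjection.ofCompleteSpace M

/-- (Ported verbatim from the HodgeCMPerL package; no docstring in the source.) -/
instance hatσ_hasOrthogonalProjection (i : T.SigIdx V c) : ((T.core V c).hatσ i).HasOrthogonalProjection :=
  hasOrthogonalProjection_of_isClosed V c _ ((T.core V c).hatσ_closed i)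

/-- The interface's `e_σ̂` is the orthogonal projection onto `σ̂` (from `eσ_mem`, `eσ_fix`, `eσ_selfAdjoint`). -/
theorem eσ_eq_starProjection (i : T.SigIdx V c) (u : T.H V c) :
    (T.core V c).eσ i u = ((T.core V c).hatσ i).starProjection u := by
  symm
  apply Submodule.eq_starProjection_of_mem_orthogonal ((T.core V c).eσ_mem i u)
  rw [Submodule.mem_orthogonal]
  intro m hm
  rw [inner_sub_right, ← (T.core V c).eσ_selfAdjoint i m u, (T.core V c).eσ_fix i m hm, sub_self]

/-- The interface's `R` is a unitary representation in the sense of `Pv09.Spectral`. -/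
theorem isUnitaryRep_R : Spectral.IsUnitaryRep (T.core V c).R := (T.core V c).R_unitary

end

/-- **N22 (i) KERNEL-PROVED** (tex l. 386–387): given X₁, every `e_σ̂` preserves every closed
`R(U(W)(𝔸))`-invariant subspace — the frozen field `AX9_espectral` DISCHARGED (not used). -/
theorem N22_espectral_of_isotypic (hiso : IsotypicStable T) {L : CMField} {ι₁ : L →+* ℂ}
    (V : HermSpace3 L ι₁) (c : SeesawCtx L) (M : Submodule ℂ (T.H V c))
    (hM : IsClosed (M : Set (T.H V c))) (hinv : ∀ g, ∀ v ∈ M, (T.core V c).R g v ∈ M)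
    (i : T.SigIdx V c) : ∀ v ∈ M, (T.core V c).eσ i v ∈ M := by
  haveI := hasOrthogonalProjection_of_isClosed V c M hM
  intro v hv
  rw [eσ_eq_starProjection]
  exact Spectral.isotypic_projection_preserves (isUnitaryRep_R V c) ((T.core V c).hatσ i) (hiso V c i) M hinv
    v hv

/-- **N22 as an honest split**: `IsotypicStable T → WVector T → N22_spectral T`, conjunct (i) kernel-proved,
conjunct (ii) the labelled input X₂. -/
theorem N22_of_inputs (hiso : IsotypicStable T) (hw : WVector T) : N22_spectral T :=
  fun V c => ⟨fun M hM hinv i v hv => N22_espectral_of_isotypic T hiso V c M hM hinv i v hv,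
    fun M hM hinv i hi hne => hw V c M hM hinv i hi hne⟩

end PerL34
end HodgeCM
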